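import Summits.AtomisticToContinuum.BoseEinsteinCondensation.Theorems.BECStronglyRayleighLatticeToPeriodicBridgeMuffinTinDefs

/-!
# Route `BECStronglyRayleigh`, crux `LatticeToPeriodicBridge` (stmt-AtomisticToContinuum-9674),
# line `muffin-tin-reward-supermodularity` — S2 reshaped: the deep-well condensate limit (skeleton v3)

Companion of the line's Defs module (`…MuffinTinDefs.lean`, p96108/p96476). Wave-1 scoping audit of the registered stub
`Sig.stub_deepWallBand := DeepWallBand` (stub worker of lead prover-line-stmt-AtomisticToContinuum-9674-1; audit
`work/stubs/S2_audit.md` attached to the item as evidence) found no false corner and no mis-statement (`E = ⊤` cannot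
arise for `b₀ > R₀`; Mott `N = M³` gives equality `ofReal z_w`; `v = 0` a.e. gives `z_w·N ≥ LHS`; the hopping sign is
ferromagnetic, off-diagonal `−½ ≤ 0`, so `cohSum = M³·n_{k=0}` of the Perron sector vector is the right deep-limit
quantity), and isolated the ONE analytic fact the stub is conditional on — stated here as `DeepWellCondensateLimit`
(fixed geometry `(v, R₀, w, M, L, N)`, two explicit thick-wall hypotheses `2R₀ < wL/M` and `R₀ < (1−w)L/M`, existential
near-minimiser form: `δ` arbitrary at fixed `λ`, i.e. genuine ground-state information). Its analytic parts: (P1) the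
one-body square-barrier Kronig–Penney deep-band limit (folklore ODE; Reed–Simon IV XIII.16; no Mathlib support), (P2) an
`N`-body Feshbach–Schur / tight-binding reduction with `v ∈ [0,∞]` and wall slab `s > 2R₀` — NOT in print beyond one body
(Helffer–Sjöstrand, Comm. PDE 9 (1984) 337) and two wells (Rougerie–Spehner, CMP 361 (2018) 737), (P3) readout algebra and
the `L²`-Lipschitz bound of `n₀` (in tree). The glue `deepWallBand_of_deepWellCondensateLimit : DeepWellCondensateLimit →
DeepWallBand` is proved below (`b₀ := (2R₀⁺+1)/w + (R₀⁺+1)/(1−w)`), so skeleton v3 registers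
`stub_deepWellCondensateLimit : Sig.stub_deepWellCondensateLimit` in place of `stub_deepWallBand`.
-/

noncomputable section

namespace Summit.AtomisticToContinuum.BoseEinsteinCondensation.Cruxes.LatticeToPeriodicBridge.MuffinTinRewardSupermodularity

open MeasureTheory Filter
open scoped ENNReal NNReal BigOperators Topology
open Literature.MathematicalPhysics.QuantumManyBody.BoseGas
open Literature.MathematicalPhysics.QuantumLattice
open Literature.Probability.LatticeModels (TorusSite)
open Summit.AtomisticToContinuum.BoseEinsteinCondensation.Theses
open Summit.AtomisticToContinuum.BoseEinsteinCondensation.Theses.BECStronglyRayleigh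

/-- **S2' — the deep-well condensate limit (many-body tight-binding reduction, existential
near-minimiser form; NOT in tree, NOT in print for `N` bosons in `M³` wells; the registered open stub of skeleton v3
replacing `DeepWallBand`).**  Fix a measurable
radial profile `v` vanishing beyond `R₀ ≥ 0`, a wall fraction `w ∈ (0,1)`, `M ≥ 2`, a side `L > 0`
with `2R₀ < wL/M` and `R₀ < (1-w)L/M`, `1 ≤ N ≤ M³`, and a normalised sector-`N` ground vector `ψ`
of `xyTorus 3 M 1`.  Then for every `ε > 0`, for all sufficiently large wall heights `λ`, for EVERY
window `δ > 0` there is a `δ`-near-minimiser `Ψ` of `Ψ ↦ E_v[Ψ] + λ⟨W⟩_Ψ` with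
`n₀(Ψ) ≥ z_w·cohSum(ψ)/M³ - ε`.  (Because `δ` is arbitrary at fixed `λ`, this is genuine
ground-state information: `liminf_λ inf_{gs} n₀ ≥ z_w·cohSum/M³`; for `v ≠ 0` a.e. it is an
equality in the limit, for `v = 0` a.e. the limit is `z_w·N ≥ z_w·cohSum/M³`.) Size XL (analysis not in Mathlib; (P2) not
in print). Stub statement — deliberately untagged. -/
def DeepWellCondensateLimit : Prop :=
  ∀ (v : ℝ → ℝ≥0∞) (R₀ : ℝ), Measurable v → 0 ≤ R₀ → (∀ r, R₀ < r → v r = 0) →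
    ∀ w : ℝ, 0 < w → w < 1 →
      ∀ (M : ℕ) [NeZero M], 2 ≤ M → ∀ L : ℝ, 0 < L →
        2 * R₀ < w * (L / M) → R₀ < (1 - w) * (L / M) →
        ∀ N : ℕ, 1 ≤ N → N ≤ M ^ 3 →
          ∀ ψ : TensorIndex (TorusSite 3 M) 2 → ℂ, IsSectorGround M N ψ →
            ∀ ε : ℝ, 0 < ε → ∀ᶠ lam : ℝ in atTop, ∀ δ : ℝ≥0∞, 0 < δ →
              ∃ Ψ : PeriodicTrialState N L,
                twoCouplingFunctional v M w lam 0 Ψ ≤ twoCouplingEnergy v N L M w lam 0 + δ ∧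
                ENNReal.ofReal (deepShare w / (M : ℝ) ^ 3 * cohSum ψ N - ε) ≤
                  condensateOccupation N L Ψ.ψ

/-- An `ℝ≥0∞` squeeze: if `ofReal (a - ε) ≤ b` for every `ε > 0` then `ofReal a ≤ b`. [folklore] -/
theorem ofReal_le_of_forall_sub_le {a : ℝ} {b : ℝ≥0∞}
    (h : ∀ ε : ℝ, 0 < ε → ENNReal.ofReal (a - ε) ≤ b) : ENNReal.ofReal a ≤ b := by
  refine ENNReal.le_of_forall_pos_le_add fun ε hε _ => ?_
  calc ENNReal.ofReal a = ENNReal.ofReal ((a - ε) + ε) := by rw [sub_add_cancel]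
    _ ≤ ENNReal.ofReal (a - ε) + ENNReal.ofReal (ε : ℝ) := ENNReal.ofReal_add_le
    _ ≤ b + ε := by
        rw [ENNReal.ofReal_coe_nnreal]
        gcongr
        exact h ε (by exact_mod_cast hε)

/-- Registered signature of `stub_deepWellCondensateLimit` (S2' of skeleton v3, open): the statement `DeepWellCondensateLimit`.
Stub statement — deliberately untagged. -/
abbrev Sig.stub_deepWellCondensateLimit : Prop := DeepWellCondensateLimit

/-- **Glue: S2' ⇒ S2.**  With `b₀ := (2R₀⁺ + 1)/w + (R₀⁺ + 1)/(1 - w)` (`R₀⁺ = max R₀ 0`), `L ≥ b₀ M`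
gives the two thick-wall hypotheses of `DeepWellCondensateLimit`, and the near-minimisers it provides
bound `n₀⁺(λ,0) = ⨅_δ ⨆_{δ-near-min} n₀` below eventually in `λ`, hence its `liminf`. [folklore] -/
theorem deepWallBand_of_deepWellCondensateLimit (hX : DeepWellCondensateLimit) : DeepWallBand := by
  intro v hv w hw0 hw1
  obtain ⟨hmeas, R, hR⟩ := hv
  -- nonnegative range
  set R₀ : ℝ := max R 0 with hR₀def
  have hR₀ : 0 ≤ R₀ := le_max_right _ _
  have hvR₀ : ∀ r, R₀ < r → v r = 0 := fun r hr => hR r (lt_of_le_of_lt (le_max_left _ _) hr)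
  have h1w : 0 < 1 - w := sub_pos.mpr hw1
  refine ⟨(2 * R₀ + 1) / w + (R₀ + 1) / (1 - w), by positivity, ?_⟩
  intro M _ hM L hL N hN1 hN2 ψ hψ
  have hMpos : (0 : ℝ) < M := by exact_mod_cast (lt_of_lt_of_le (by norm_num) hM : 0 < M)
  have hb₀pos : 0 < (2 * R₀ + 1) / w + (R₀ + 1) / (1 - w) := by positivity
  have hLpos : 0 < L := lt_of_lt_of_le (by positivity) hL
  have hLM : (2 * R₀ + 1) / w + (R₀ + 1) / (1 - w) ≤ L / M := by
    rw [le_div_iff₀ hMpos]; exact hL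
  have hwall : 2 * R₀ < w * (L / M) := by
    have h1 : (2 * R₀ + 1) / w ≤ L / M :=
      le_trans (le_add_of_nonneg_right (by positivity)) hLM
    have h2 : w * ((2 * R₀ + 1) / w) = 2 * R₀ + 1 := by field_simp
    nlinarith [mul_le_mul_of_nonneg_left h1 hw0.le]
  have hwell : R₀ < (1 - w) * (L / M) := by
    have h1 : (R₀ + 1) / (1 - w) ≤ L / M :=
      le_trans (le_add_of_nonneg_left (by positivity)) hLM
    have h2 : (1 - w) * ((R₀ + 1) / (1 - w)) = R₀ + 1 := by field_simp
    nlinarith [mul_le_mul_of_nonneg_left h1 h1w.le]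
  have key := hX v R₀ hmeas hR₀ hvR₀ w hw0 hw1 M hM L hLpos hwall hwell N hN1 hN2 ψ hψ
  refine ofReal_le_of_forall_sub_le fun ε hε => ?_
  refine le_liminf_of_le (by isBoundedDefault) ?_
  filter_upwards [key ε hε] with lam hlam
  unfold upperCondensate
  refine le_iInf₂ fun δ hδ => ?_
  obtain ⟨Ψ, hΨF, hΨn⟩ := hlam δ hδ
  exact le_iSup₂_of_le Ψ hΨF hΨn

end Summit.AtomisticToContinuum.BoseEinsteinCondensation.Cruxes.LatticeToPeriodicBridge.MuffinTinRewardSupermodularity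

end
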